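import Literature.NumberTheory.Automorphic.ArthurClozelFibresHolds
import Literature.NumberTheory.Automorphic.AutomorphicInductionCuspidalProofs
import HarnessLib

/-!
# Arthur–Clozel, Ch. 3, Thm. 3.1 (quadratic case): `ArthurClozel_fibres_quadratic` from
# Jacquet–Shalika (2.2)–(2.3) and multiplicity one alone

Topic `NumberTheory/Automorphic`; namespace `Literature.NumberTheory.Automorphic`. Proof file
(theorems only: no definition, no named fact), the last link of the chain
`ArthurClozelFibresRepData` → `ArthurClozelFibresHolds` for the named fact
`Literature.NumberTheory.Automorphic.ArthurClozel_fibres_quadratic` of `TunnellLemma`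
(Arthur–Clozel 1989, Ch. 3, Thm. 3.1 for a quadratic extension `M/K`, at the level of Hecke
matrices almost everywhere, for cuspidal automorphic representations of `GL_n(𝔸_K)` in the
Borel–Jacquet model).

`ArthurClozel_fibres_quadratic_of_leaves'` (`ArthurClozelFibresHolds`) grants seven inputs. Three of
them — the Borel–Jacquet dictionary between `A_G`-invariant cuspidal data and `L²_cusp` (`hA`:
`AutomorphicRepsGL.exists_isAssociatedL2`, `hL2`: `hasSatakeParamAt_iff_L2`) and the clean models
(`hcl`) — served only to build the unitary normalisation "We may assume `π, π'` unitary"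
(Borel–Jacquet 1979, 5.7), which is meanwhile an unconditional theorem of the tree,
`CuspidalAutomorphicRepData.exists_satake_eq_cpow_mul_L2_unconditional`
(`AutomorphicInductionCuspidalProofs`: clean models from the semisimplicity of `𝒜_cusp^{A_G}`,
`AutomorphicRepsGL.stable_cuspidal_eq_sSup_irreducible_holds`, and the realisation theorem
`AutomorphicRepsGL.exists_le_formsOfL2_of_W'_eq_bot_holds`). Feeding it into
`ArthurClozel_fibres_quadratic_of_normalisation` leaves exactly the four printed analytic inputs of
Arthur–Clozel's proof (p. 200, (2.2)–(2.3), "by [JS]") and multiplicity one: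

* `JacquetShalika1981_partialPairL_at_one_of_ne_conj` — (2.2) at `s = 1`: `L^S(s, π × π̃')` has a
  finite limit at `s = 1` for `π' ≇ π` (*Euler products II*, Prop. 3.6);
* `JacquetShalika1981_partialPairL_boundary_of_ne_one` — (2.2) on the line `re s = 1`, `s ≠ 1`;
* `JacquetShalika1981_partialPairL_pole_of_eq_conj` — (2.3): a pole at `s = 1` for `π' = π`;
* `multiplicity_one_gl` — multiplicity one on `L²_cusp(GL_n)` (Shalika 1974; Piatetski-Shapiro 1979).

Result: `ArthurClozel_fibres_quadratic_holds_of` — the named fact from these four named facts of the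
tree (`PairLFunctionPoles`, `AutomorphicGLn`), all still undischarged in general rank; its trust
base is therefore exactly this set. (Fact-decomposition record, librarian `libsplit-33`,
2026-08-16: the fact is ALREADY decomposed in the tree; no new named fact is introduced.)

## References

* J. Arthur, L. Clozel, *Simple algebras, base change, and the advanced theory of the trace
  formula*, Ann. of Math. Stud. 120 (1989), Ch. 3 §2 (2.1)–(2.3) (p. 200), Thm. 3.1 and its proof
  (p. 201). [ArthurClozelAMS120]
* H. Jacquet, J. A. Shalika, *On Euler products and the classification of automorphic forms II*,
  Amer. J. Math. 103 (1981), 777–815, Prop. 3.6. [JacquetShalikaAJM1981II]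
* A. Borel, H. Jacquet, *Automorphic forms and automorphic representations*, Proc. Sympos. Pure
  Math. 33 (1979), part 1, 5.7. [BorelJacquetCorvallis1979]
-/

noncomputable section

open scoped MatrixGroups NNReal Classical
open NumberField IsDedekindDomain MeasureTheory Filter

namespace Literature.NumberTheory.Automorphic

open AdelicGroupData

/-- **Arthur–Clozel, Ch. 3, Thm. 3.1 (quadratic case, Borel–Jacquet data) from Jacquet–Shalika
(2.2)–(2.3) and multiplicity one.** Granting, for all `GL_n` over all number fields and all
automorphic measures, Jacquet–Shalika (2.2) at `s = 1` (`h22`) and on the boundary line (`h22'`),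
(2.3) (`h23`) and multiplicity one on `L²_cusp(GL_n)` (`hm1`) — four named facts of the tree — the
named fact `ArthurClozel_fibres_quadratic` holds: for a quadratic extension `M/K` and cuspidal
automorphic representations `π, π'` of `GL_n(𝔸_K)` with `t_{π,w}^{f(x|w)} = t_{π',w}^{f(x|w)}` for
almost all places `x` of `M`, either `t_{π'} = t_π` almost everywhere or
`t_{π',w} = ε_{M/K}(w) t_{π,w}` almost everywhere. This is
`ArthurClozel_fibres_quadratic_of_normalisation` with the automorphic measures
(`AdelicGroupData.exists_isAutomorphicMeasure_gl_holds`), Jacquet–Shalika (2.1)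
(`JacquetShalika1981_multipliable_partialPairL_holds`), the quadratic Hecke characters `η_{M/K}`
(`exists_heckeCharacter_quadraticSign_of_finrank_eq_two`) and the unitary normalisation
(`CuspidalAutomorphicRepData.exists_satake_eq_cpow_mul_L2_unconditional`) supplied by theorems.
[cite: ArthurClozelAMS120, Ch. 3, Thm. 3.1 and its proof (p. 201)] -/
theorem ArthurClozel_fibres_quadratic_holds_of
    (h22 : ∀ {n : ℕ} {K : Type} [Field K] [NumberField K] {μ : Measure (gl n K).automorphicQuotient}
      [(gl n K).IsAutomorphicMeasure μ],
      JacquetShalika1981_partialPairL_at_one_of_ne_conj (n := n) (K := K) (μ := μ))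
    (h22' : ∀ {n : ℕ} {K : Type} [Field K] [NumberField K] {μ : Measure (gl n K).automorphicQuotient}
      [(gl n K).IsAutomorphicMeasure μ],
      JacquetShalika1981_partialPairL_boundary_of_ne_one (n := n) (m := n) (K := K) (μ := μ) (μ' := μ))
    (h23 : ∀ {n : ℕ} {K : Type} [Field K] [NumberField K] {μ : Measure (gl n K).automorphicQuotient}
      [(gl n K).IsAutomorphicMeasure μ],
      JacquetShalika1981_partialPairL_pole_of_eq_conj (n := n) (K := K) (μ := μ))
    (hm1 : ∀ (n : ℕ) (K : Type) [Field K] [NumberField K] (μ : Measure (gl n K).automorphicQuotient)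
      [(gl n K).IsAutomorphicMeasure μ], multiplicity_one_gl n K μ) :
    ArthurClozel_fibres_quadratic :=
  ArthurClozel_fibres_quadratic_of_normalisation
    (fun n K _ _ => AdelicGroupData.exists_isAutomorphicMeasure_gl_holds n K)
    JacquetShalika1981_multipliable_partialPairL_holds
    h22 h22' h23 hm1
    (fun hKM => by
      obtain ⟨ω, hωfin, hω⟩ := exists_heckeCharacter_quadraticSign_of_finrank_eq_two hKM
      exact ⟨ω, hωfin, hω.mono fun w hw => hw.2⟩)
    (fun hK μ _ π => CuspidalAutomorphicRepData.exists_satake_eq_cpow_mul_L2_unconditional hK μ π)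

end Literature.NumberTheory.Automorphic

end
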